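import Summits.BirchSwinnertonDyer.BirchSwinnertonDyer.Theorems.ByReductionTypeAtTwoOrdKatoHalfAtTwoIsoZetaColemanMuDefs
import Summits.BirchSwinnertonDyer.BirchSwinnertonDyer.Theses.ByReductionTypeAtTwo
import HarnessLib

/-!
# Crux `OrdKatoHalfAtTwoIso` (stmt-BirchSwinnertonDyer-19573), line `steinberg-fibre-at-two` — RESTATE CERTIFICATE for
# child stmt-BirchSwinnertonDyer-23760 `OrdKatoFineZetaAtTwoResidue` (lead g4, after p678187)

Nothing asserted; `sorry`-free. (1) `restated23760_text_iff`: the proposed re-typed text of child 23760 — fully qualified,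
route-file vocabulary only (the route file cannot import `…ZetaColemanMuDefs`, which imports it) — is `Iff.rfl` the
Theorems constant `SteinbergFibreAtTwo.ZetaColemanMuInputsNegDiscAtTwo` (p678187). (2) `ordKatoHalfAtTwoIsoOfChildren_restated_text`:
the split glue with the re-typed second child closes BY NAME by one application of
`SteinbergFibreAtTwo.ordKatoHalfAtTwoIso_of_zetaColemanMu_cite` (p678187). (3) `old_child_implies_new_per_datum`: pointer —
the filed text (= `DivisibilityInputsFineZetaAtTwoResidue`) implies the new one datum by datum on the residue
(`hasZetaColemanMuInputsAtTwo_of_divisibilityInputs`, kernel); on the added habitat (ρ_{2^∞} onto, Δ < 0) the new text is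
the μ-part of W_K2 Thm. B. BSD is not proved; the crux and child 23760 stay OPEN.
-/

set_option linter.dupNamespace false

namespace Summit.BirchSwinnertonDyer.BirchSwinnertonDyer.Cruxes.OrdKatoHalfAtTwoIso.SteinbergFibreAtTwo.Restate23760

open Summit.BirchSwinnertonDyer.BirchSwinnertonDyer.Theses.ByReductionTypeAtTwo
open Summit.BirchSwinnertonDyer.BirchSwinnertonDyer.Theorems

/-- PROPOSED TEXT of child 23760 (re-cut socket 2; route vocabulary, fully qualified). [folklore] -/
def OrdKatoFineZetaAtTwoResidueRestatedText : Prop :=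
  ∀ (W : WeierstrassCurve ℚ) [W.IsElliptic] [W.IsGloballyMinimal] [ContinuousSMul (PadicInt 2) (W.tateModule 2)] [Module.Free (PadicInt 2) (W.tateModule 2)] [Module.Finite (PadicInt 2) (W.tateModule 2)] {N : ℕ} [NeZero N] (f : CuspForm (Subgroup.map (Matrix.SpecialLinearGroup.mapGL ℝ) (CongruenceSubgroup.Gamma0 N)) 2) (κ : Literature.NumberTheory.EllipticCurves.ZpExtension ℚ 2) (γ : Field.absoluteGaloisGroup ℚ) (hκ : κ.IsCyclotomic), Literature.NumberTheory.EllipticCurves.IsOrdinaryAt W 2 → W.HasSurjectiveModNGaloisRep 2 → W.Δ < 0 → κ.IsTopGenerator γ → Literature.NumberTheory.EllipticCurves.IsCyclotomicVariable 2 γ → Literature.NumberTheory.EllipticCurves.ModularForms.IsNewformOf W f → ∀ (D : W.SelmerDualData κ γ) (Y : W.FineSelmerDualData κ γ), ∃ (I : Literature.NumberTheory.EllipticCurves.Kato2004.IwasawaH1Data W 2 κ γ) (Z : Submodule (Literature.NumberTheory.EllipticCurves.IwasawaAlgebra 2) I.H) (P : Submodule (Literature.NumberTheory.EllipticCurves.IwasawaAlgebra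 2) (Literature.NumberTheory.EllipticCurves.IwasawaAlgebra 2)) (ℓ : I.H →ₗ[Literature.NumberTheory.EllipticCurves.IwasawaAlgebra 2] P) (τ : P →ₗ[Literature.NumberTheory.EllipticCurves.IwasawaAlgebra 2] D.X) (π : D.X →ₗ[Literature.NumberTheory.EllipticCurves.IwasawaAlgebra 2] Y.X), Z ≤ Submodule.span (Literature.NumberTheory.EllipticCurves.IwasawaAlgebra 2) {s : I.H | Literature.NumberTheory.EllipticCurves.Kato2004.IsEulerSystemClassTwo W hκ I s} ∧ (∀ z ∈ Z, τ (ℓ z) = 0) ∧ Function.Surjective π ∧ Function.Exact τ π ∧ ∀ G₁ : Literature.NumberTheory.EllipticCurves.IwasawaAlgebra 2, Literature.NumberTheory.EllipticCurves.iwasawaToPowerSeries 2 G₁ = Literature.NumberTheory.EllipticCurves.padicLFunction f (Literature.NumberTheory.EllipticCurves.unitRoot W 2 : ℚ_[2]) → ∃ s : Literature.NumberTheory.EllipticCurves.IwasawaAlgebra 2, s ∉ Literature.NumberTheory.EllipticCurves.IwasawaAlgebra.augIdealP 2 ∧ s * G₁ ∈ Submodule.map (P.subtype ∘ₗ ℓ)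 Z

/-- (1) The proposed text is VERBATIM (`Iff.rfl`) the Theorems constant `ZetaColemanMuInputsNegDiscAtTwo`. [folklore] -/
theorem restated23760_text_iff :
    OrdKatoFineZetaAtTwoResidueRestatedText ↔ SteinbergFibreAtTwo.ZetaColemanMuInputsNegDiscAtTwo :=
  Iff.rfl

/-- (2) The split glue with the re-typed second child closes by name (one application of p678187's door). [folklore] -/
theorem ordKatoHalfAtTwoIsoOfChildren_restated_text :
    OrdKatoIsoPrintBundleAtTwo → OrdKatoFineZetaAtTwoResidueRestatedText → OrdKatoMuPartOptimalAtTwo →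
      OrdKatoIntSurjectiveAtTwo → OrdKatoHalfAtTwoIso :=
  fun hB hF1 hB7 hB8 => SteinbergFibreAtTwo.ordKatoHalfAtTwoIso_of_zetaColemanMu_cite hF1 hB.2 hB7 hB8 hB.1

/-- (3) Pointer: the filed child text implies the new one per datum on the residue (kernel, p678187). [folklore] -/
example := @SteinbergFibreAtTwo.hasZetaColemanMuInputsAtTwo_of_divisibilityInputs

end Summit.BirchSwinnertonDyer.BirchSwinnertonDyer.Cruxes.OrdKatoHalfAtTwoIso.SteinbergFibreAtTwo.Restate23760
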